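import Summits.HodgeConjecture.HodgeConjecture.Theorems.F0P6aDatumOfInputsDefsOrgans
import HarnessLib

/-!
## Import provenance (CANONICAL HEADER — LEAD F0P6-plan (g6) «M-142a» (A): bare `import` lines only; their provenance notes, verbatim)

- `import Summits.HodgeConjecture.HodgeConjecture.Theorems.F0P6aDatumOfInputsDefsOrgans` -- ★ previous part of the same Lines workfile `F0_P6a_DatumOfInputs` (Defs side; size-lint split ×4)

# `F0P6aDatumOfInputsDefs` — ★ RE-HOME of the DEFS SIDE of `Lines/F0_P6a_DatumOfInputs.lean` (ED. 3 a42642215a80d44d), PART 4 of 4 (LAST — the module the hub `Lines/F0_P6a_DatumOfInputs.lean` ED. 4 and the K6 twins import) = §3★ the socket TYPES `StubDOWNType`, `StubFROBType`, `DatumOfLineType` (closed `Prop`s, ED. 3 :758–767 ⊕ :796–816 ∕ :835–869 ∕ :884–911 verbatim) and the ★-shaped head `datum_of_inputs_star (hL : type_of% @L1Fold.stub_LINES_of_organs) (hD : StubDOWNType) (hF : StubFROBType) : DatumOfLineType` (body ED. 3 :967–1009 verbatim) — shape (H1b′), LA2-p01 (g5) probe 3c0ce4e28dfd824d, LEAD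 «M-140a» (1) ADOPTED.  v3 = CURE (A) of the v2 5549158e dry-run bounce `dedup.landed` (gate 2026-09-02T22:51:14Z: a `Theorems/` theorem may not RESTATE an importable ★ declaration, and v2՚s §1★ `stub_LINES` BY TERM `:= L1Fold.stub_LINES_of_organs I` is, to the gate, ★ PART 3՚s `L1Fold.stub_LINES_of_organs` again): §1★ is DROPPED ★-side — `stub_LINES` (BY TERM) and its junction STAY in the hub `Lines/F0_P6a_DatumOfInputs.lean` ED. 4 BY FQN (ED. 3 :750–783 verbatim there; importers unchanged) — and the head՚s first binder reads the ★ organ head՚s type `type_of% @L1Fold.stub_LINES_of_organs` (= `type_of% @stub_LINES` as a Π-type: ED. 3 :719 keeps the frame instances on the organ head on purpose; ED. 3 junction :783; K6 MAIN v5f :655 passes `@L1Fold.stub_LINES_of_organs`, LEAD «M-142f»).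

See PART 1 `Theorems/F0P6aDatumOfInputsDefsDock.lean` for the full re-home header and the hub՚s ED. 3 docstring (verbatim there).  Namespace and sections KEPT; code bytes =
the workfile՚s, docstrings included; options preamble repeated from PART 1.
HONEST LABEL: HC_CM is proved only modulo the 7 printed citations (2 remaining named inputs hLiu418 = stmt-HodgeConjecture-24832, h413 = stmt-HodgeConjecture-24833) until rung 0 closes; a re-home is count-neutral.

CITE FORMS OF RECORD for the three CLOSED socket-type `Prop`s of §3★ (their own docstrings spell the locators as `(print: …)` — gate rule «STATE IT INLINE»: a closed `def … : Prop` in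
`Theorems/` whose docstring carries a cite TOKEN is relocated to `Literature/…`; ★ precedent `Theorems/F0P6aModuliDatumDefs.lean` `RecordModuliDatumCofinal`; the forms stay visible here and on
the hub՚s sockets): [cite: Liu2021, Prop. D.8 p. 135, pp. 136–138] [cite: Liu2021, Prop. D.8 (3) p. 135, pp. 136–138] [cite: Tate1997FiniteFlatGroupSchemes, (3.7)] [cite: Carayol1986Compositio, §10.3 Prop. p. 211]
[cite: Shimura1998, §13.1 Thm. 1 (pp. 97–99); §18.6 p. 127] [cite: RapoportSmithlingZhang2020Diagonal, §3.2 p. 11, §4.3 (4.23) p. 21] [cite: RapoportSmithlingZhang2020Diagonal, §4.1 Thm. 4.1 p. 17] [cite: Kottwitz1992, §5 pp. 389–391]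
-/

set_option autoImplicit false

noncomputable section

namespace Summit.HodgeConjecture.HodgeConjecture.Cruxes.HLiu418.F0P6aDatumOfInputs

set_option linter.dupNamespace false  -- `Summit.HodgeConjecture.HodgeConjecture.…` BY DESIGN (D-0017)

open CategoryTheory CategoryTheory.Limits NumberField IsDedekindDomain MulAction
open scoped Matrix Polynomial Pointwise MonoidalCategory
open Literature.NumberTheory.GaloisRepresentations
open Literature.NumberTheory.Automorphic Literature.NumberTheory.Automorphic.UnitaryGroup
open Literature.AlgebraicGeometry.ShimuraVarieties.UnitaryCanonicalModel
open Literature.NumberTheory.Automorphic.Liu2021.AppendixC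
open Literature.AlgebraicGeometry.Motives (AlgPoints IntegralModel SchemeOver thickening thickeningGalAction thickeningLift specOver relFrobeniusOver frobeniusTwistOver)
open Literature.NumberTheory.DiophantineGeometry (geomResidueField specialFibreFunctor specResidueField)
open Literature.AlgebraicGeometry.RelativeSpec (ActionOver)
open Literature.NumberTheory.EllipticCurves (genericFibre)
open Literature.AlgebraicGeometry.GroupSchemes.AffineGroupScheme (Alg quotIncl)
open Summit.HodgeConjecture.HodgeConjecture.Cruxes.HLiu418.F0P6cDictConstructors (kerFI AdmSub IdealIsEtale isAdm_kerFI)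
open Summit.HodgeConjecture.HodgeConjecture.Cruxes.HLiu418.F0P6aModuliDatumDefs
open Summit.HodgeConjecture.HodgeConjecture.Cruxes.HLiu418.F0P6aRGDAssembly

/-! ### §3★ THE SOCKET TYPES AND THE ★-SHAPED HEAD (shape (H1b′): LA2-p01 (g5) probe `DatumOfInputs.starYield.probe.v1` 3c0ce4e28dfd824d GREEN, LEAD «M-140a» (1) ADOPTED).
The two remaining sockets՚ TYPES as closed `Prop`s — frame = the hub՚s `section Stubs` `variable` block (ED. 3 :758–767) as leading `∀`-binders, then the socket՚s explicit binders and
conclusion (ED. 3 :796–816 ∕ :835–869) VERBATIM, same order, same binder kinds —, the closed statement of the hub head `datum_of_line` (:884–911) as `DatumOfLineType`, and the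
★-shaped parametric head `datum_of_inputs_star (hL : type_of% @L1Fold.stub_LINES_of_organs) (hD : StubDOWNType) (hF : StubFROBType) : DatumOfLineType` with the body of the hub՚s `datum_of_inputs`
(:967–1009) VERBATIM.  Sorry-free, calls no socket.  The hub ED. 4 keeps `stub_DOWN`∕`stub_FROB` (`sorry`), `datum_of_line`, `datum_of_inputs` BY FQN and certifies ORDER (`example :
StubDOWNType := @stub_DOWN`, …) and JUNCTION both ways (`example : type_of% @datum_of_inputs := @datum_of_inputs_star`, …); a ★ closer leaf certifies `example : StubDOWNType :=
@stub_DOWN_of_organs` WITHOUT importing the hub (pass socket terms WITH `@` against these `def`s: no implicit-lambda is inserted through a `def`). -/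

set_option maxHeartbeats 400000 in
/-- **`StubDOWNType`** — the TYPE of the hub socket `stub_DOWN` (ED. 3 :796–816) as a closed `Prop` (frame :758–767 + explicit binders, verbatim).  NOT asserted (a TYPE, paid by the closer leaf `Lines/F0_P6a_StubDOWN.lean`). (print: Liu2021, Prop. D.8 p. 135, pp. 136–138) (print: Tate1997FiniteFlatGroupSchemes, (3.7)) (print: Carayol1986Compositio, §10.3 Prop. p. 211) -/
def StubDOWNType : Prop :=
  ∀ {F : Type} [Field F] [NumberField F] [IsCMField F] [IsGalois ℚ F] {ι₁ : F →+* ℂ}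
    {Jstar : Matrix (Fin 2) (Fin 2) F}
    {K₀ : C5.OpenCompactSubgroup ↥(finAdelic ↥(maximalRealSubfield F) F (IsCMField.complexConj F) 2 Jstar)}
    {S : RecordSystemGS F Jstar ι₁ K₀} {hU7ₛ : S.HeckeTranslateDefinedOver}
    {hJ : (Jstar.map (IsCMField.complexConj F))ᵀ = Jstar} {hJu : IsUnit Jstar}
    {Fi : Type} [Field Fi] [Algebra F Fi] [FiniteDimensional F Fi] [IsGalois F Fi] {Kc : C5.SmallLevel K₀} {G : Type} [Group G] [Finite G]
    {𝓜 : IntegralModel (𝓞 F) F ((thickening F Fi).obj (S.M.obj Kc))}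
    {w : HeightOneSpectrum (𝓞 F)} {hw : (IsCMField.complexConj F) • w ≠ w} {h𝓨 : (𝓜.localise w).IsSmoothProper 1}
    {θ : ActionOver (𝓜.localise w).total.hom ((Fi ≃ₐ[F] Fi) × G)}
    {e : Fi →ₐ[F] AlgebraicClosure (w.adicCompletion F)}
    (I : RGDInputsAt F ι₁ Jstar K₀ S hU7ₛ hJ hJu Fi Kc G 𝓜 w hw h𝓨 θ e) [ExpChar (geomResidueField w) I.pChar]
    (𝔡 : ∀ xbar, DockAt I xbar)
    (quotΩ : ∀ y, LineOf I y → AlgPoints (S.M.obj Kc) (AlgebraicClosure (w.adicCompletion F)))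
    (translΩ : AlgPoints (S.M.obj Kc) (AlgebraicClosure (w.adicCompletion F)) → AlgPoints (S.M.obj Kc) (AlgebraicClosure (w.adicCompletion F)))
    (_hhecke : HeckeClause I quotΩ translΩ) (_hroof : RoofLink I quotΩ) (_hroof₂ : RoofLink₂ I translΩ)
    (_hθ : ∀ γ : Fi ≃ₐ[F] Fi,
       (genericFibre (HeightOneSpectrum.valuationSubringAtPrime F w) F).map
             (Over.isoMk (θ.aut (γ, 1)) (θ.aut_comp (γ, 1))).hom ≫ (𝓜.localise w).genericIso'.hom
         = (𝓜.localise w).genericIso'.hom ≫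
             (Over.isoMk ((thickeningGalAction (L := Fi) (S.M.obj Kc)).aut γ)
               ((thickeningGalAction (L := Fi) (S.M.obj Kc)).aut_comp γ)).hom)
    (_hunit : (UnitaryGroup.isUnit_placeForm Jstar hJu w).unit ∈ glInt 2 (w.adicCompletion F))
    (_hKc : UnitaryGroup.IsHyperspecialAt ↥(maximalRealSubfield F) F (IsCMField.complexConj F) 2 Jstar Kc.1.1
      (w.under (𝓞 ↥(maximalRealSubfield F))))
    (_hdisj : haveI : AlgebraicGeometry.IsProper (𝓜.localise w).total.hom := h𝓨.2
      ∀ (β : Fi ≃ₐ[F] Fi) (P Q : AlgPoints (S.M.obj Kc) (AlgebraicClosure (w.adicCompletion F))),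
        (𝓜.localise w).geomReductionMap (thickeningLift e (S.M.obj Kc) P) =
          AlgPoints.map ((specialFibreFunctor w).map (Over.isoMk (θ.aut (β, 1)) (θ.aut_comp (β, 1))).hom :
              (𝓜.localise w).reductionAt ⟶ (𝓜.localise w).reductionAt)
            ((𝓜.localise w).geomReductionMap (thickeningLift e (S.M.obj Kc) Q)) → β = 1),
    Nonempty (DownReadings I 𝔡 quotΩ translΩ)

set_option maxHeartbeats 400000 in
/-- **`StubFROBType`** — the TYPE of the hub socket `stub_FROB` (ED. 3 :835–869) as a closed `Prop` (frame :758–767 + explicit binders, verbatim).  NOT asserted (a TYPE, paid by the closer leaf `Lines/F0_P6a_StubFROB.lean`). (print: Liu2021, Prop. D.8 (3) p. 135, pp. 136–138) (print: Shimura1998, §13.1 Thm. 1 (pp. 97–99); §18.6 p. 127) (print: RapoportSmithlingZhang2020Diagonal, §3.2 p. 11, §4.3 (4.23) p. 21) -/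
def StubFROBType : Prop :=
  ∀ {F : Type} [Field F] [NumberField F] [IsCMField F] [IsGalois ℚ F] {ι₁ : F →+* ℂ}
    {Jstar : Matrix (Fin 2) (Fin 2) F}
    {K₀ : C5.OpenCompactSubgroup ↥(finAdelic ↥(maximalRealSubfield F) F (IsCMField.complexConj F) 2 Jstar)}
    {S : RecordSystemGS F Jstar ι₁ K₀} {hU7ₛ : S.HeckeTranslateDefinedOver}
    {hJ : (Jstar.map (IsCMField.complexConj F))ᵀ = Jstar} {hJu : IsUnit Jstar}
    {Fi : Type} [Field Fi] [Algebra F Fi] [FiniteDimensional F Fi] [IsGalois F Fi] {Kc : C5.SmallLevel K₀} {G : Type} [Group G] [Finite G]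
    {𝓜 : IntegralModel (𝓞 F) F ((thickening F Fi).obj (S.M.obj Kc))}
    {w : HeightOneSpectrum (𝓞 F)} {hw : (IsCMField.complexConj F) • w ≠ w} {h𝓨 : (𝓜.localise w).IsSmoothProper 1}
    {θ : ActionOver (𝓜.localise w).total.hom ((Fi ≃ₐ[F] Fi) × G)}
    {e : Fi →ₐ[F] AlgebraicClosure (w.adicCompletion F)}
    (I : RGDInputsAt F ι₁ Jstar K₀ S hU7ₛ hJ hJu Fi Kc G 𝓜 w hw h𝓨 θ e) [ExpChar (geomResidueField w) I.pChar]
    (𝔡 : ∀ xbar, DockAt I xbar)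
    (quotΩ : ∀ y, LineOf I y → AlgPoints (S.M.obj Kc) (AlgebraicClosure (w.adicCompletion F)))
    (translΩ : AlgPoints (S.M.obj Kc) (AlgebraicClosure (w.adicCompletion F)) → AlgPoints (S.M.obj Kc) (AlgebraicClosure (w.adicCompletion F)))
    (_hhecke : HeckeClause I quotΩ translΩ) (_hroof : RoofLink I quotΩ) (_hroof₂ : RoofLink₂ I translΩ) (𝔯 : DownReadings I 𝔡 quotΩ translΩ)
    (_hunit : (UnitaryGroup.isUnit_placeForm Jstar hJu w).unit ∈ glInt 2 (w.adicCompletion F))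
    (_hKc : UnitaryGroup.IsHyperspecialAt ↥(maximalRealSubfield F) F (IsCMField.complexConj F) 2 Jstar Kc.1.1
      (w.under (𝓞 ↥(maximalRealSubfield F))))
    (_hdisj : haveI : AlgebraicGeometry.IsProper (𝓜.localise w).total.hom := h𝓨.2
      ∀ (β : Fi ≃ₐ[F] Fi) (P Q : AlgPoints (S.M.obj Kc) (AlgebraicClosure (w.adicCompletion F))),
        (𝓜.localise w).geomReductionMap (thickeningLift e (S.M.obj Kc) P) =
          AlgPoints.map ((specialFibreFunctor w).map (Over.isoMk (θ.aut (β, 1)) (θ.aut_comp (β, 1))).hom :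
              (𝓜.localise w).reductionAt ⟶ (𝓜.localise w).reductionAt)
            ((𝓜.localise w).geomReductionMap (thickeningLift e (S.M.obj Kc) Q)) → β = 1),
    ∃ (twistIdeal : (Fi ≃ₐ[F] Fi) → Ideal (𝓞 F)) (twistNorm : (Fi ≃ₐ[F] Fi) → ℕ) (frobIdeal : (Fi ≃ₐ[F] Fi) → Ideal (𝓞 F)),
      (∀ (σ : Field.absoluteGaloisGroup (w.adicCompletion F)), IsAbsArithFrob σ → ∀ γ : Fi ≃ₐ[F] Fi,
        ((AlgEquiv.restrictScalars F (Field.absoluteGaloisGroup.toAlgEquiv (w.adicCompletion F) σ) :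
            AlgebraicClosure (w.adicCompletion F) ≃ₐ[F] AlgebraicClosure (w.adicCompletion F)) :
            AlgebraicClosure (w.adicCompletion F) →ₐ[F] AlgebraicClosure (w.adicCompletion F)).comp e = e.comp (γ : Fi →ₐ[F] Fi) →
        frobIdeal γ * w.asIdeal = twistIdeal γ) ∧
      (∀ (σ : Field.absoluteGaloisGroup (w.adicCompletion F)), IsAbsArithFrob σ → ∀ γ : Fi ≃ₐ[F] Fi,
        ((AlgEquiv.restrictScalars F (Field.absoluteGaloisGroup.toAlgEquiv (w.adicCompletion F) σ) :
            AlgebraicClosure (w.adicCompletion F) ≃ₐ[F] AlgebraicClosure (w.adicCompletion F)) :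
            AlgebraicClosure (w.adicCompletion F) →ₐ[F] AlgebraicClosure (w.adicCompletion F)).comp e = e.comp (γ : Fi →ₐ[F] Fi) →
        twistNorm γ = I.pChar ^ I.fDeg) ∧
      (∀ (σ : Field.absoluteGaloisGroup (w.adicCompletion F)), IsAbsArithFrob σ → ∀ γ : Fi ≃ₐ[F] Fi,
        ((AlgEquiv.restrictScalars F (Field.absoluteGaloisGroup.toAlgEquiv (w.adicCompletion F) σ) :
            AlgebraicClosure (w.adicCompletion F) ≃ₐ[F] AlgebraicClosure (w.adicCompletion F)) :
            AlgebraicClosure (w.adicCompletion F) →ₐ[F] AlgebraicClosure (w.adicCompletion F)).comp e = e.comp (γ : Fi →ₐ[F] Fi) →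
        ∀ y : AlgPoints (S.M.obj Kc) (AlgebraicClosure (w.adicCompletion F)),
          FrobCover₀ 𝓜 w I.univ I.act I.dual I.pol I.lvl I.pChar I.fDeg (twistIdeal γ) (twistNorm γ)
            (red₀Of S Kc 𝓜 w h𝓨 e (σ • y)) (red₀Of S Kc 𝓜 w h𝓨 e y)) ∧
      (∀ γ : Fi ≃ₐ[F] Fi, twistIdeal γ ⊔ Ideal.span {((I.N : ℕ) : 𝓞 F)} = ⊤) ∧
      (∀ γ : Fi ≃ₐ[F] Fi, twistIdeal γ ≠ ⊥) ∧
      Quot₀RoofLaw I 𝔡 quotΩ 𝔯.spec.sp frobIdeal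

set_option maxHeartbeats 400000 in
/-- **`DatumOfLineType`** — the closed statement of the hub head `datum_of_line` (ED. 3 :884–911) = the TYPE of the spine socket `stub_DATUM`, as a `Prop`, verbatim.  NOT asserted here (a TYPE; inhabited by `datum_of_inputs_star` below from the three socket types). (print: Liu2021, Prop. D.8 p. 135, pp. 136–138) (print: RapoportSmithlingZhang2020Diagonal, §4.1 Thm. 4.1 p. 17) -/
def DatumOfLineType : Prop :=
  ∀ (F : Type) [Field F] [NumberField F] [IsCMField F] [IsGalois ℚ F] (ι₁ : F →+* ℂ)
    (Jstar : Matrix (Fin 2) (Fin 2) F)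
    (K₀ : C5.OpenCompactSubgroup ↥(finAdelic ↥(maximalRealSubfield F) F (IsCMField.complexConj F) 2 Jstar))
    (S : RecordSystemGS F Jstar ι₁ K₀) (hU7ₛ : S.HeckeTranslateDefinedOver)
    (hJ : (Jstar.map (IsCMField.complexConj F))ᵀ = Jstar) (hJu : IsUnit Jstar)
    (Fi : Type) [Field Fi] [Algebra F Fi] [FiniteDimensional F Fi] [IsGalois F Fi]
    (Kc : C5.SmallLevel K₀) (G : Type) [Group G] [Finite G]
    (𝓜 : IntegralModel (𝓞 F) F ((thickening F Fi).obj (S.M.obj Kc)))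
    (w : HeightOneSpectrum (𝓞 F)) (hw : (IsCMField.complexConj F) • w ≠ w) (h𝓨 : (𝓜.localise w).IsSmoothProper 1)
    (θ : ActionOver (𝓜.localise w).total.hom ((Fi ≃ₐ[F] Fi) × G))
    (_hθ : ∀ γ : Fi ≃ₐ[F] Fi,
       (genericFibre (HeightOneSpectrum.valuationSubringAtPrime F w) F).map
             (Over.isoMk (θ.aut (γ, 1)) (θ.aut_comp (γ, 1))).hom ≫ (𝓜.localise w).genericIso'.hom
         = (𝓜.localise w).genericIso'.hom ≫
             (Over.isoMk ((thickeningGalAction (L := Fi) (S.M.obj Kc)).aut γ)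
               ((thickeningGalAction (L := Fi) (S.M.obj Kc)).aut_comp γ)).hom)
    (e : Fi →ₐ[F] AlgebraicClosure (w.adicCompletion F))
    (_hunit : (UnitaryGroup.isUnit_placeForm Jstar hJu w).unit ∈ glInt 2 (w.adicCompletion F))
    (_hKc : UnitaryGroup.IsHyperspecialAt ↥(maximalRealSubfield F) F (IsCMField.complexConj F) 2 Jstar Kc.1.1
      (w.under (𝓞 ↥(maximalRealSubfield F))))
    (_hdisj : haveI : AlgebraicGeometry.IsProper (𝓜.localise w).total.hom := h𝓨.2
      ∀ (β : Fi ≃ₐ[F] Fi) (P Q : AlgPoints (S.M.obj Kc) (AlgebraicClosure (w.adicCompletion F))),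
        (𝓜.localise w).geomReductionMap (thickeningLift e (S.M.obj Kc) P) =
          AlgPoints.map ((specialFibreFunctor w).map (Over.isoMk (θ.aut (β, 1)) (θ.aut_comp (β, 1))).hom :
              (𝓜.localise w).reductionAt ⟶ (𝓜.localise w).reductionAt)
            ((𝓜.localise w).geomReductionMap (thickeningLift e (S.M.obj Kc) Q)) → β = 1),
    RGDInputsAt F ι₁ Jstar K₀ S hU7ₛ hJ hJu Fi Kc G 𝓜 w hw h𝓨 θ e →
      Nonempty (ModuliDatum F ι₁ Jstar K₀ S hU7ₛ hJ hJu Fi Kc G 𝓜 w hw h𝓨 θ e)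

set_option maxHeartbeats 400000 in
/-- **★-SHAPED PARAMETRIC HEAD `datum_of_inputs_star`** — the hub՚s `datum_of_inputs` (ED. 3 :966) with the three hypotheses and the conclusion spelled through the closed types
`type_of% @L1Fold.stub_LINES_of_organs` (★ PART 3՚s organ head = the hub socket `stub_LINES`՚s type token for token; v3 cure (A)), `StubDOWNType`, `StubFROBType` ⊢ `DatumOfLineType`; body = ED. 3 :967–1009 VERBATIM (`intro` goes through the `def`, `hD I …` ∕ `hF I …`
unfold at default transparency — LA2-p01 (g5) (H1b′), first try, no `unfold`).  Sorry-free; calls no socket; `--axioms` = {propext, Classical.choice, Quot.sound}.  This is the head the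
K-series MAIN port reads ★-side (`rgd_of_inputs … (datum_of_inputs_star @L1Fold.stub_LINES_of_organs @<DOWN closer head> @<FROB closer head>) …`; MAIN v5f :655, LEAD «M-142f»).
[cite: Liu2021, Prop. D.8 p. 135, pp. 136–138] [cite: RapoportSmithlingZhang2020Diagonal, §4.1 Thm. 4.1 p. 17] [cite: Kottwitz1992, §5 pp. 389–391] -/
theorem datum_of_inputs_star (hL : type_of% @L1Fold.stub_LINES_of_organs) (hD : StubDOWNType) (hF : StubFROBType) : DatumOfLineType := by
  intro F _ _ _ _ ι₁ Jstar K₀ S hU7ₛ hJ hJu Fi _ _ _ _ Kc G _ _ 𝓜 w hw h𝓨 θ hθ e hunit hKc hdisj I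
  classical
  haveI : CharP (geomResidueField w) I.pChar := I.charP₀
  haveI : ExpChar (geomResidueField w) I.pChar := ExpChar.prime I.hpChar.1
  have 𝔡 : ∀ xbar, DockAt I xbar := fun xbar => Classical.choice (nonempty_dockAt I xbar)
  obtain ⟨quotΩ, translΩ, hhecke, hroof, hroof₂⟩ := hL I
  obtain ⟨𝔯⟩ := hD I 𝔡 quotΩ translΩ hhecke hroof hroof₂ hθ hunit hKc hdisj
  obtain ⟨twistIdeal, twistNorm, frobIdeal, hfrobIdeal, htwistNorm, hcover, hcoprime, hnebot, hroof₀⟩ :=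
    hF I 𝔡 quotΩ translΩ hhecke hroof hroof₂ 𝔯 hunit hKc hdisj
  exact ⟨{
    Line := LineOf I
    Sub := SubOf I 𝔡
    kerF := kerFOf I 𝔡
    IsEtale := fun {_} H => IsEtaleOf I 𝔡 H
    quotΩ := quotΩ
    translΩ := translΩ
    quot := 𝔯.spec.quot
    transl := 𝔯.spec.transl
    sp := 𝔯.spec.sp
    hecke := hhecke
    red_quotΩ := 𝔯.spec.red_quotΩ
    red_translΩ := 𝔯.spec.red_translΩ
    smap := 𝔯.spec.smap
    smap_kerF := 𝔯.spec.smap_kerF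
    quot_smap := 𝔯.spec.quot_smap
    univ := I.univ
    act := I.act
    dual := I.dual
    pol := I.pol
    g := I.g
    N := I.N
    lvl := I.lvl
    inj₀ := I.inj₀
    twistIdeal := twistIdeal
    twistIdeal_coprime := hcoprime
    twistIdeal_ne_bot := hnebot
    pChar := I.pChar
    hpChar := I.hpChar
    twistNorm := twistNorm
    fDeg := I.fDeg
    charP₀ := I.charP₀
    block₀ := blockOf I 𝔡 𝔯
    frob₀ := frobOf I 𝔡 𝔯 hfrobIdeal htwistNorm hcover hroof₀ }⟩


end Summit.HodgeConjecture.HodgeConjecture.Cruxes.HLiu418.F0P6aDatumOfInputs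

end
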